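import Literature.Geometry.Riemannian.SurgicalRicciFlow
import Literature.Geometry.Riemannian.PinchingEstimates
import HarnessLib

/-!
# Solutions of the Ricci flow with surgery under the a priori assumptions (Chen–Zhu 2006, §5):
# the statement of Theorem 5.6, and Theorem 1.1 as its consequence
(topic `Geometry/Riemannian`)

Layer RF6 of the decomposition of `Literature.Geometry.Riemannian.hamilton_chen_tang_zhu`
(`HamiltonPICProofs.lean`), one level below `SurgicalRicciFlow.lean`. That file vends **Chen–Zhu
2006, Thm. 1.1** (J. Differential Geom. 74 (2006); arXiv:math/0504478, p. 3) — the *structure*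
of the outcome of the Ricci flow with surgery on a compact simply connected 4-manifold of positive
isotropic curvature — as the statement `∀ M g₀, … → ∃ m, ChenZhuResolvableIn m M g₀` (formerly the
named fact `chenZhu_ricciFlowWithSurgery`; since the review of 2026-08-15 it is no longer a named
fact but the explicit hypothesis of the bridge to Hamilton's Cor. 1.2(a), being equivalent to
`hamilton_chen_tang_zhu` modulo short-time existence and Cerf's theorem,
`ChenZhuStructureFromClassification.lean`). In print Thm. 1.1 "is a direct consequence of" (p. 43) the
long-time existence theorem **Thm. 5.6** (p. 43), whose solution carries more than the structure
(i)–(iv): it is a *solution to the Ricci flow with surgery* in the sense of **Def. 5.1** (p. 26;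
in particular every stage has positive isotropic curvature) which satisfies the **a priori
assumptions** of §5 (p. 26) — Hamilton's *pinching assumption* (5.1)–(5.3) with the constants of
the initial metric and the *canonical neighbourhood assumption* with accuracy `ε` and parameter
`r = r̃(t)` — and which becomes extinct at a time `T ≤ 2/R_min(0)` (p. 30: "the maximal time `T`
of any solution to the Ricci flow with `δ`-cutoff surgeries must be bounded by `2/R_min(0)`";
p. 43). This file

* renders "a solution to the Ricci flow with surgery with `m` surgery times, built from `(M, g₀)`
  by the surgeries of §5 and satisfying the a priori assumptions with parameters `𝔭`, started at
  absolute time `t₀` and extinct at absolute time `t₁`" as the predicate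
  `ChenZhuSurgicalFlowIn 𝔭 m M g₀ t₀ t₁`, by recursion on `m` exactly as `ChenZhuResolvableIn`
  (`SurgicalRicciFlow.lean`: each stage is the maximal Ricci flow from its initial metric,
  consecutive stages are related by `IsSurgeryStep`, the last manifold `IsUnionOfPieces`), each
  stage being time-shifted to start at `0` (the flow is autonomous) while the **absolute** start
  time `t₀` is carried along, because the a priori assumptions are not shift-invariant (`e^{Pt}`
  in (5.3), `r̃(t)` in the canonical neighbourhood assumption);
* renders the statement of **Thm. 5.6** over it (simply connected case; the quantifier prefix of
  the a priori assumptions, p. 26; the bound `T ≤ 2/R_min(0)`, p. 30) and PROVES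
  Thm. 5.6 ⇒ Thm. 1.1 with that statement as an explicit hypothesis:
  `chenZhu_ricciFlowWithSurgery_of_surgicalSolution_existence` (forgetting the a priori
  assumptions and the time bound, `ChenZhuSurgicalFlowIn.resolvableIn`), through the per-manifold
  form `chenZhu_ricciFlowWithSurgery_of_surgicalFlowIn` (the bare existence clause suffices);
* does NOT vend Thm. 5.6 as a named fact (see "Why Thm. 5.6 is not a named fact" below);
* PROVES the base of Chen–Zhu's induction (p. 26: "It follows from Lemma 2.1 and Theorem 4.1 that
  the a priori assumptions above hold for the smooth solution on `[0, T₀)`") in this vocabulary,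
  from the named facts `hamilton_chenZhu_pinching` (Lemma 2.1),
  `chenZhu_aprioriAssumptions_smoothSolution` (Thm. 4.1 as used on p. 26) and
  `ricciFlow_preserves_positiveIsotropicCurvature` (Hamilton 1997, Thm. B1.2):
  `chenZhuAPriori_smoothSolution`.

## The a priori assumptions of one stage (`ChenZhuAPriori 𝔭 g cov T t₀`), and two weakenings

For a stage `g` on `M × [0, T)` (Levi-Civita witnesses `cov`) starting at absolute time `t₀`, with
parameters `𝔭 = (ε, C₁, C₂, η, ρ, Λ, P, r)` (`ChenZhuAPrioriParams`):
* `pic`: every `g t` has positive isotropic curvature (Def. 5.1);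
* `pinching`: (5.1)–(5.3) in every orthonormal frame at every point and local time `t`, the
  improved pinching (5.3) at the ABSOLUTE time `t₀ + t` (`Matrix.PinchedBy`,
  `Matrix.ImprovedPinchingAt` of `PinchingEstimates.lean`);
* `canonical`: every `(x, t)` with `R(x, t) ≥ r(t₀ + t)⁻²` **whose parabolic window
  `[t - R(x,t)⁻¹, t]` lies inside the stage** (`R(x,t)⁻¹ ≤ t`) has a canonical neighbourhood with
  accuracy `ε` and constants `C₁, C₂, η` (`HasCanonicalNeighbourhood` of
  `CanonicalNeighbourhoods.lean`, for the stage's own flow on `Ico 0 T`).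
Two deviations from print, both WEAKENINGS (so that the vended existence statement is implied by
the printed one): (1) necks are `C⁰`-close only (inherited from `HasCanonicalNeighbourhood`, see
`Necks.lean`); (2) the window restriction: in print the strong `ε`-neck alternative (a) looks back
over `[t - R⁻¹, t]` "where the solution is well defined on the whole parabolic neighbourhood",
which for a surgical solution may reach into the previous stage through the identification of
the isometric domains `N_k` (Def. 5.1); the time-shifted stage vocabulary cannot express this, so
the assumption is asserted here only where the window stays inside the stage (where the printed
alternative (a) is a strong `ε`-neck of the stage flow itself). A rendering over the space-time of
Def. 5.1 would remove (2).

## Why Thm. 5.6 is not a named fact (D-0026), and where its statement lives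

Thm. 5.6 was vended here (2026-08-15) as a named fact `chenZhu_surgicalSolution_existence` next
to Thm. 1.1 (`chenZhu_ricciFlowWithSurgery`, `SurgicalRicciFlow.lean`), with Thm. 1.1 proved from
it in eight lines. That cut moved no proof burden: Thm. 5.6 IS the analytic theory of the paper
(§5 over §§2–4 and the Appendix, on Perelman's techniques: Lemmas 5.2, 5.3, 5.5, Prop. 5.4, the
volume count of p. 43), it has no decomposition into medium-sized published results, and
Thm. 1.1 is "a direct consequence" of it (p. 43) — one unproved theory-sized fact had become two.
Under the fact decomposition discipline (D-0026: a named fact may be introduced next to the fact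
it serves only as a distinct, medium-sized published result through an explicit split) the
review of that split MERGED Thm. 5.6 back into the proof obligation of Thm. 1.1 (itself merged, by
the next review, into `hamilton_chen_tang_zhu`, the tree's single leaf for the Hamilton–Chen–Zhu
classification), and the statement
of Thm. 5.6 — unchanged, in the rendering below — is (verbatim) the explicit hypothesis of the
proved reduction `chenZhu_ricciFlowWithSurgery_of_surgicalSolution_existence` in this file and
the conclusion of the proved count `chenZhu_surgicalSolution_existence_of_step`
(`SurgicalSolutionsCount.lean`, p. 43 "Summing up": Thm. 5.6 from the base of the induction and
the surgery step), whose composition `chenZhu_ricciFlowWithSurgery_of_step` is the discharge path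
of Thm. 1.1. Nothing printed is asserted without proof in this file.

**The rendering of Thm. 5.6** (p. 43): "Given a compact four-dimensional Riemannian manifold
with positive isotropic curvature and with no essential incompressible space form, and given
any fixed small constant `ε > 0`, there exist non-increasing positive (continuous) functions
`δ̃(t)` and `r̃(t)`, defined on `[0, +∞)`, such that for arbitrarily given positive (continuous)
function `δ(t)` with `δ(t) ≤ δ̃(t)` on `[0, +∞)`, the Ricci flow with surgery, with the given
four-manifold as initial datum, has a solution satisfying the the pinching assumption and the
canonical neighborhood assumption (with accuracy `ε`) with `r = r̃(t)` on a maximal time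
interval `[0, T)` with `T < +∞` and becoming extinct at `T`, which is obtained by evolving the
Ricci flow and by performing a finite number of cutoff surgeries with each `δ`-cutoff at time
`t ∈ (0, T)` having `δ = δ(t)`." Moreover (p. 30; p. 43, "Summing up"): "`T ≤ 2/R_min(0) < +∞`".
Quantifiers as in the printed a priori assumptions (p. 26) and as in
`chenZhu_aprioriAssumptions_smoothSolution`: `η` universal, a smallness threshold `ε₀` for the
"fixed small constant `ε`", `C₁, C₂` depending only on `ε`, then, given the manifold — `M : Type`
closed (compact, Hausdorff, second countable, `C^∞`, on `ℝ⁴`; any Borel structure, for the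
volumes) and **simply connected** (the vacuous case of "no essential incompressible space form")
with a `C^∞` Riemannian metric `g₀` of positive isotropic curvature — positive pinching constants
`ρ, Λ, P` (in the proof those of the initial metric, Lemma 2.1 and Lemma 5.3) and `r̃` positive
and non-increasing on `[0, ∞)`, and then `m` and `T` such that `(M, g₀)`, started at time `0`, is
carried to extinction at time `T` by a solution with `m` surgeries satisfying the a priori
assumptions with parameters `(ε, C₁, C₂, η, ρ, Λ, P, r̃)` (`ChenZhuSurgicalFlowIn`), with
`T ≤ 2/α` for every positive lower bound `α` of the scalar curvature of `g₀`.

Thm. 5.6 quantifies "for arbitrarily given positive function `δ(t) ≤ δ̃(t)`" and produces a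
solution whose surgeries are `δ(t)`-cutoff surgeries (p. 29: along `δ`-necks of Lemma 5.2, gluing
the standard capped cylinder with the constants of Lemma 5.3). The `δ`-fineness of the necks and
caps is not recorded by the structural `IsSurgeryStep` (which says where the manifold is cut and
what is glued, Thm. 1.1 (i)–(iii), not how round the necks are); it needs the `C^{[δ⁻¹]}` necks
of `CkNecks.lean` and the standard capped cylinder (layer RF5, to come), as do Lemma 5.2,
Lemma 5.3, Prop. 5.4 and Lemma 5.5, from which Thm. 5.6 is proved in print (p. 43: `V(t) ≤ V(0)`,
each cutoff removes volume `≥ h⁴`, hence finitely many surgeries). Since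
"`∀ δ ≤ δ̃, ∃` solution" implies "`∃` solution", and the `κ`-noncollapsing of Prop. 5.4 is not part
of the statement of Thm. 5.6, the rendering is implied by the printed theorem (with the two
weakenings of `ChenZhuAPriori` above); the hypothesis "no essential incompressible space form" is
taken in its vacuous case `π₁(M) = 1`, as in the rendering of Thm. 1.1 (`SurgicalRicciFlow.lean`).

## References

* B.-L. Chen, X.-P. Zhu, *Ricci flow with surgery on four-manifolds with positive isotropic
  curvature*, J. Differential Geom. 74 (2006) 177–264, arXiv:math/0504478: Thm. 1.1 (p. 3),
  Lemma 2.1 (p. 4), Def. 5.1 and the a priori assumptions (p. 26), p. 30 (`T ≤ 2/R_min(0)`),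
  Prop. 5.4 (p. 30), Thm. 5.6 and "Summing up" (p. 43). [ChenZhu2006]
* R. S. Hamilton, *Four-manifolds with positive isotropic curvature*, Comm. Anal. Geom. 5 (1997),
  Thm. B1.1, B1.2, B2.3 (§2), D3.1 (§4). [Hamilton1997]
-/

noncomputable section

open Bundle Set Function TopologicalSpace
open scoped Manifold ContDiff Topology

namespace Literature.Geometry.Riemannian

open Lorentzian

/-- Local notation: `𝔼 n` is the model Euclidean space `EuclideanSpace ℝ (Fin n)`. -/
local notation "𝔼 " n:arg => EuclideanSpace ℝ (Fin n)

/-- Local notation: smooth pseudo-Riemannian metrics on the tangent bundle of a 4-manifold `M`. -/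
local notation "Metric₄ " M:arg =>
  PseudoRiemannianMetric (𝓡 4) ∞ (EuclideanSpace ℝ (Fin 4)) (TangentSpace (𝓡 4) : M → Type _)

/-- Local notation: covariant derivatives on the tangent bundle of a 4-manifold `M`. -/
local notation "Connection₄ " M:arg =>
  CovariantDerivative (𝓡 4) (EuclideanSpace ℝ (Fin 4)) (TangentSpace (𝓡 4) : M → Type _)

/-! ### Parameters and the a priori assumptions of one stage -/

/-- **Parameters of the a priori assumptions** (Chen–Zhu 2006, §5, p. 26): the accuracy `ε`, the
constants `C₁ = C₁(ε)`, `C₂ = C₂(ε)` and the universal `η` of the canonical neighbourhood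
assumption, the constants `ρ, Λ, P` of the pinching assumption (5.1)–(5.3) (in §5 those of the
initial metric, Lemma 2.1 and Lemma 5.3), and the parameter `r : [0, ∞) → (0, ∞)` of the
canonical neighbourhood assumption (`r = r̃(t)` in Thm. 5.6), a function of ABSOLUTE time.
[cite: ChenZhu2006, §5, p. 26 (a priori assumptions)] -/
structure ChenZhuAPrioriParams where
  /-- The accuracy `ε` of the canonical neighbourhood assumption. -/
  ε : ℝ
  /-- The constant `C₁(ε)` (`σ < C₁ R(x,t)^{-1/2}`). -/
  C₁ : ℝ
  /-- The constant `C₂(ε)` (curvature comparability and volume bound). -/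
  C₂ : ℝ
  /-- The universal constant `η` of the gradient estimates (5.4). -/
  η : ℝ
  /-- The pinching constant `ρ` of (5.1)–(5.3). -/
  ρ : ℝ
  /-- The pinching constant `Λ` of (5.2)–(5.3). -/
  Λ : ℝ
  /-- The pinching constant `P` of (5.3) (`Λ e^{Pt}`). -/
  P : ℝ
  /-- The canonical neighbourhood parameter `r(t)`, a function of absolute time `t ≥ 0`. -/
  r : ℝ → ℝ

section Stage

variable {M : Type} [TopologicalSpace M] [T2Space M] [CompactSpace M] [ChartedSpace (𝔼 4) M]
  [IsManifold (𝓡 4) ∞ M] [MeasurableSpace M] [BorelSpace M]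

/-- **The stage `g` on `M × [0, T)`, started at absolute time `t₀`, has positive isotropic
curvature and satisfies the a priori assumptions with parameters `𝔭`** (Chen–Zhu 2006, Def. 5.1
and §5, p. 26, for one of the smooth solutions `g^{(k)}(t)` of a solution with surgery,
time-shifted to start at `0`; `t₀ = t_k⁻` is its printed initial time). Writing
`R(x, t) = scalarCurvatureWith (g t) (cov t) x`:
* `pic` — "smooth solutions … with positive isotropic curvature" (Def. 5.1): every `g t`,
  `t ∈ [0, T)`, has positive isotropic curvature;
* `pinching` — the **pinching assumption** (5.1)–(5.3) "everywhere": in every `g t`-orthonormal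
  frame `e` at every `x` and `t ∈ [0, T)`, Hamilton's blocks `A, B, C` satisfy (5.1)–(5.2)
  (`Matrix.PinchedBy … ρ Λ`) and (5.3) at the absolute time `t₀ + t`
  (`Matrix.ImprovedPinchingAt … ρ Λ P (t₀ + t)`);
* `canonical` — the **canonical neighbourhood assumption (with accuracy `ε`)** with parameter
  `r`: every `(x, t)` with `R(x,t) ≥ r(t₀ + t)⁻²` whose parabolic window lies in the stage
  (`R(x,t)⁻¹ ≤ t`) has a canonical neighbourhood (`HasCanonicalNeighbourhood`, C⁰ form, for the
  flow `g` on `Ico 0 T`) with constants `C₁, C₂, η`.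
The window restriction and the C⁰ necks make this WEAKER than the printed assumptions (module
docstring). [cite: ChenZhu2006, Def. 5.1 and §5, p. 26 (a priori assumptions)] -/
structure ChenZhuAPriori (𝔭 : ChenZhuAPrioriParams) (g : ℝ → Metric₄ M) (cov : ℝ → Connection₄ M)
    (T t₀ : ℝ) : Prop where
  /-- Every metric of the stage has positive isotropic curvature. -/
  pic : ∀ t ∈ Ico 0 T, (g t).HasPositiveIsotropicCurvature
  /-- The pinching assumption (5.1)–(5.3), (5.3) at absolute time `t₀ + t`. -/
  pinching : ∀ t ∈ Ico 0 T, ∀ (x : M) (e : Fin 4 → TangentSpace (𝓡 4) x),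
    (g t).IsOrthonormalFrame x e →
      Matrix.PinchedBy ((g t).blockA (cov t) x e) ((g t).blockB (cov t) x e)
          ((g t).blockC (cov t) x e) 𝔭.ρ 𝔭.Λ ∧
        Matrix.ImprovedPinchingAt ((g t).blockA (cov t) x e) ((g t).blockB (cov t) x e)
          ((g t).blockC (cov t) x e) 𝔭.ρ 𝔭.Λ 𝔭.P (t₀ + t)
  /-- The canonical neighbourhood assumption with accuracy `ε` and parameter `r(t₀ + ·)`, at the
  points whose parabolic window `[t - R⁻¹, t]` lies inside the stage. -/
  canonical : ∀ t ∈ Ico 0 T, ∀ x : M,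
    (𝔭.r (t₀ + t))⁻¹ ^ 2 ≤ (g t).scalarCurvatureWith (cov t) x →
      ((g t).scalarCurvatureWith (cov t) x)⁻¹ ≤ t →
        HasCanonicalNeighbourhood g cov (Ico 0 T) x t 𝔭.ε 𝔭.C₁ 𝔭.C₂ 𝔭.η

/-- The canonical neighbourhood assumption of a stage persists under enlarging `C₁`
(`HasCanonicalNeighbourhood.mono_C₁`); the other parameters are kept. [folklore] -/
theorem ChenZhuAPriori.mono_C₁ {𝔭 : ChenZhuAPrioriParams} {g : ℝ → Metric₄ M}
    {cov : ℝ → Connection₄ M} {T t₀ C₁' : ℝ} (h : ChenZhuAPriori 𝔭 g cov T t₀)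
    (hC : 𝔭.C₁ ≤ C₁') : ChenZhuAPriori { 𝔭 with C₁ := C₁' } g cov T t₀ where
  pic := h.pic
  pinching := h.pinching
  canonical t ht x hR hw := (h.canonical t ht x hR hw).mono_C₁ hC

end Stage

/-! ### Solutions with surgery satisfying the a priori assumptions (Def. 5.1 + p. 26 + §5) -/

/-- **`(M, g₀)`, started at absolute time `t₀`, is carried to extinction at absolute time `t₁` by
a solution of the Ricci flow with `m` surgeries satisfying the a priori assumptions with
parameters `𝔭`** — Chen–Zhu 2006, Def. 5.1 ("a collection of compact four-dimensional smooth
solutions `g^{(k)}(t)` to the Ricci flow on `M_k × [t_k⁻, t_k⁺)` … with positive isotropic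
curvature, which go singular as `t → t_k⁺` … `t_k⁻ = t⁺_{k-1}`, and `(Ω_{k-1}, ḡ^{(k-1)})` and
`(M_k, g^{(k)}(t_k⁻))` contain compact (possibly disconnected) four-dimensional submanifolds with
smooth boundary which are isometric"), together with the a priori assumptions (p. 26) on every
stage and the structure of the surgeries and of the extinct manifold (§5, pp. 27–30; Thm. 1.1
(i)–(iv) as rendered by `IsSurgeryStep` / `IsUnionOfPieces` in `SurgicalRicciFlow.lean`). By
recursion on `m`, each stage time-shifted to start at `0`:
* `m = 0`: the maximal Ricci flow `g` on `[0, T)` from `g₀` satisfies the assumptions (started at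
  `t₀`), `t₁ = t₀ + T`, and `M` is a finite union of pieces ("the solution becomes extinct",
  p. 27);
* `m + 1`: the maximal flow `g` on `[0, T)` from `g₀` satisfies the assumptions, and one surgery
  at time `T` (`IsSurgeryStep`) yields a closed 4-manifold `M'` (with its Borel σ-algebra, for the
  volumes in the assumptions) and a metric `g₀'` such that `(M', g₀')`, started at absolute time
  `t₀ + T`, is carried to extinction at `t₁` with `m` surgeries.
[cite: ChenZhu2006, Def. 5.1 (p. 26) and §5, pp. 26–30] -/
def ChenZhuSurgicalFlowIn (𝔭 : ChenZhuAPrioriParams) : ℕ → ∀ (M : Type) [TopologicalSpace M]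
    [T2Space M] [SecondCountableTopology M] [CompactSpace M] [ChartedSpace (𝔼 4) M]
    [IsManifold (𝓡 4) ∞ M] [MeasurableSpace M] [BorelSpace M], Metric₄ M → ℝ → ℝ → Prop
  | 0, M, _, _, _, _, _, _, _, _, g₀, t₀, t₁ =>
      ∃ (g : ℝ → Metric₄ M) (cov : ℝ → Connection₄ M) (T : ℝ),
        IsMaximalRicciFlow g cov T ∧ g 0 = g₀ ∧ ChenZhuAPriori 𝔭 g cov T t₀ ∧ t₁ = t₀ + T ∧
          IsUnionOfPieces M
  | m + 1, M, _, _, _, _, _, _, _, _, g₀, t₀, t₁ =>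
      ∃ (g : ℝ → Metric₄ M) (cov : ℝ → Connection₄ M) (T : ℝ),
        IsMaximalRicciFlow g cov T ∧ g 0 = g₀ ∧ ChenZhuAPriori 𝔭 g cov T t₀ ∧
        ∃ (M' : Type) (_ : TopologicalSpace M') (_ : T2Space M') (_ : SecondCountableTopology M')
          (_ : CompactSpace M') (_ : ChartedSpace (𝔼 4) M') (_ : IsManifold (𝓡 4) ∞ M')
          (_ : MeasurableSpace M') (_ : BorelSpace M') (g₀' : Metric₄ M'),
          IsSurgeryStep g T g₀' ∧ ChenZhuSurgicalFlowIn 𝔭 m M' g₀' (t₀ + T) t₁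

section Solutions

variable {𝔭 : ChenZhuAPrioriParams} {M : Type} [TopologicalSpace M] [T2Space M]
  [SecondCountableTopology M] [CompactSpace M] [ChartedSpace (𝔼 4) M] [IsManifold (𝓡 4) ∞ M]
  [MeasurableSpace M] [BorelSpace M]

/-- Unfolding the extinct case `m = 0`. [folklore] -/
theorem chenZhuSurgicalFlowIn_zero_iff (g₀ : Metric₄ M) (t₀ t₁ : ℝ) :
    ChenZhuSurgicalFlowIn 𝔭 0 M g₀ t₀ t₁ ↔
      ∃ (g : ℝ → Metric₄ M) (cov : ℝ → Connection₄ M) (T : ℝ),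
        IsMaximalRicciFlow g cov T ∧ g 0 = g₀ ∧ ChenZhuAPriori 𝔭 g cov T t₀ ∧ t₁ = t₀ + T ∧
          IsUnionOfPieces M := Iff.rfl

/-- Unfolding the case `m + 1` (one surgery, then `m` more). [folklore] -/
theorem chenZhuSurgicalFlowIn_succ_iff (m : ℕ) (g₀ : Metric₄ M) (t₀ t₁ : ℝ) :
    ChenZhuSurgicalFlowIn 𝔭 (m + 1) M g₀ t₀ t₁ ↔
      ∃ (g : ℝ → Metric₄ M) (cov : ℝ → Connection₄ M) (T : ℝ),
        IsMaximalRicciFlow g cov T ∧ g 0 = g₀ ∧ ChenZhuAPriori 𝔭 g cov T t₀ ∧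
        ∃ (M' : Type) (_ : TopologicalSpace M') (_ : T2Space M') (_ : SecondCountableTopology M')
          (_ : CompactSpace M') (_ : ChartedSpace (𝔼 4) M') (_ : IsManifold (𝓡 4) ∞ M')
          (_ : MeasurableSpace M') (_ : BorelSpace M') (g₀' : Metric₄ M'),
          IsSurgeryStep g T g₀' ∧ ChenZhuSurgicalFlowIn 𝔭 m M' g₀' (t₀ + T) t₁ := Iff.rfl

/-- **The first stage**: in every case the solution begins with the maximal Ricci flow from `g₀`,
which satisfies the a priori assumptions started at `t₀`. [cite: ChenZhu2006, Def. 5.1 (p. 26)] -/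
theorem ChenZhuSurgicalFlowIn.exists_first_stage {m : ℕ} {g₀ : Metric₄ M} {t₀ t₁ : ℝ}
    (h : ChenZhuSurgicalFlowIn 𝔭 m M g₀ t₀ t₁) :
    ∃ (g : ℝ → Metric₄ M) (cov : ℝ → Connection₄ M) (T : ℝ),
      IsMaximalRicciFlow g cov T ∧ g 0 = g₀ ∧ ChenZhuAPriori 𝔭 g cov T t₀ := by
  cases m with
  | zero =>
    obtain ⟨g, cov, T, hmax, h0, hap, -⟩ := h
    exact ⟨g, cov, T, hmax, h0, hap⟩
  | succ m =>
    obtain ⟨g, cov, T, hmax, h0, hap, -⟩ := h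
    exact ⟨g, cov, T, hmax, h0, hap⟩

end Solutions

/-- **Extinction comes strictly later than the start**: `t₀ < t₁` (every stage is a maximal flow
on `[0, T)` with `T > 0`). [folklore] -/
theorem ChenZhuSurgicalFlowIn.lt {𝔭 : ChenZhuAPrioriParams} :
    ∀ (m : ℕ) {M : Type} [TopologicalSpace M] [T2Space M] [SecondCountableTopology M]
      [CompactSpace M] [ChartedSpace (𝔼 4) M] [IsManifold (𝓡 4) ∞ M] [MeasurableSpace M]
      [BorelSpace M] {g₀ : Metric₄ M} {t₀ t₁ : ℝ},
      ChenZhuSurgicalFlowIn 𝔭 m M g₀ t₀ t₁ → t₀ < t₁ := by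
  intro m
  induction m with
  | zero =>
    intro M _ _ _ _ _ _ _ _ g₀ t₀ t₁ h
    obtain ⟨g, cov, T, hmax, -, -, rfl, -⟩ := h
    linarith [hmax.pos]
  | succ m ih =>
    intro M _ _ _ _ _ _ _ _ g₀ t₀ t₁ h
    obtain ⟨g, cov, T, hmax, -, -, M', _, _, _, _, _, _, _, _, g₀', -, hrest⟩ := h
    have := ih hrest
    linarith [hmax.pos]

/-- **Forgetting the a priori assumptions**: a solution with `m` surgeries satisfying the a priori
assumptions resolves `(M, g₀)` with `m` surgeries in the structural sense of Thm. 1.1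
(`ChenZhuResolvableIn`, `SurgicalRicciFlow.lean`) — the content of "the main theorem
(Theorem 1.1) … is a direct consequence of the above theorem [5.6]" (p. 43).
[cite: ChenZhu2006, §5, p. 43 (Thm. 1.1 from Thm. 5.6)] -/
theorem ChenZhuSurgicalFlowIn.resolvableIn {𝔭 : ChenZhuAPrioriParams} :
    ∀ (m : ℕ) {M : Type} [TopologicalSpace M] [T2Space M] [SecondCountableTopology M]
      [CompactSpace M] [ChartedSpace (𝔼 4) M] [IsManifold (𝓡 4) ∞ M] [MeasurableSpace M]
      [BorelSpace M] {g₀ : Metric₄ M} {t₀ t₁ : ℝ},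
      ChenZhuSurgicalFlowIn 𝔭 m M g₀ t₀ t₁ → ChenZhuResolvableIn m M g₀ := by
  intro m
  induction m with
  | zero =>
    intro M _ _ _ _ _ _ _ _ g₀ t₀ t₁ h
    obtain ⟨g, cov, T, hmax, h0, -, -, hpieces⟩ := h
    exact ⟨g, cov, T, hmax, h0, hpieces⟩
  | succ m ih =>
    intro M _ _ _ _ _ _ _ _ g₀ t₀ t₁ h
    obtain ⟨g, cov, T, hmax, h0, -, M', i₁, i₂, i₃, i₄, i₅, i₆, i₇, i₈, g₀', hstep, hrest⟩ := h
    exact ⟨g, cov, T, hmax, h0, M', i₁, i₂, i₃, i₄, i₅, i₆, g₀', hstep, ih hrest⟩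

/-! ### The base of the induction: the smooth solution satisfies the a priori assumptions -/

/-- **The smooth maximal solution satisfies the a priori assumptions** (Chen–Zhu 2006, §5, p. 26:
"the Ricci flow with it as initial data has a maximal solution `g_ij(x,t)` on `[0, T₀)` with
`T₀ < +∞`. Without loss of generality, after a scaling on the initial metric, we may assume
`T₀ > 1`. It follows from Lemma 2.1 and Theorem 4.1 that the a priori assumptions above hold for
the smooth solution on `[0, T₀)`") — the base case of the inductive construction of §5, in the
vocabulary `ChenZhuAPriori` (started at absolute time `0`), assembled from the named facts
`ricciFlow_preserves_positiveIsotropicCurvature` (Hamilton 1997, Thm. B1.2: PIC at all times),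
`hamilton_chenZhu_pinching` (Lemma 2.1: pinching with constants of the initial metric) and
`chenZhu_aprioriAssumptions_smoothSolution` (Thm. 4.1 as used on p. 26: canonical
neighbourhoods, `η` universal, `C₁, C₂` depending only on `ε`, `r` on the solution), for maximal
flows with `T > 1` from a PIC metric on a closed simply connected 4-manifold.
[cite: ChenZhu2006, §5, p. 26] -/
theorem chenZhuAPriori_smoothSolution
    (h₁ : ricciFlow_preserves_positiveIsotropicCurvature.{0}) (h₂ : hamilton_chenZhu_pinching.{0})
    (h₃ : chenZhu_aprioriAssumptions_smoothSolution) :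
    ∃ η : ℝ, 0 < η ∧ ∃ ε₀ : ℝ, 0 < ε₀ ∧ ∀ ε : ℝ, 0 < ε → ε ≤ ε₀ → ∃ C₁ C₂ : ℝ, 0 < C₁ ∧ 0 < C₂ ∧
      ∀ (M : Type) [TopologicalSpace M] [T2Space M] [SecondCountableTopology M] [CompactSpace M]
        [ChartedSpace (EuclideanSpace ℝ (Fin 4)) M] [IsManifold (𝓡 4) ∞ M] [SimplyConnectedSpace M]
        [MeasurableSpace M] [BorelSpace M]
        (g : ℝ → Metric₄ M) (cov : ℝ → Connection₄ M) (T : ℝ),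
        IsMaximalRicciFlow g cov T → 1 < T → (g 0).HasPositiveIsotropicCurvature →
          ∃ ρ Λ P : ℝ, 0 < ρ ∧ 0 < Λ ∧ 0 < P ∧
            ∃ r : ℝ → ℝ, (∀ t ∈ Ici (0 : ℝ), 0 < r t) ∧ AntitoneOn r (Ici 0) ∧
              ChenZhuAPriori ⟨ε, C₁, C₂, η, ρ, Λ, P, r⟩ g cov T 0 := by
  obtain ⟨η, hη, ε₀, hε₀, H⟩ := h₃
  refine ⟨η, hη, ε₀, hε₀, fun ε hε hεε₀ ↦ ?_⟩
  obtain ⟨C₁, C₂, hC₁, hC₂, Hcan⟩ := H ε hε hεε₀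
  refine ⟨C₁, C₂, hC₁, hC₂, fun M _ _ _ _ _ _ _ _ _ g cov T hmax hT hpic ↦ ?_⟩
  obtain ⟨ρ, Λ, P, hρ, hΛ, hP, hpinch⟩ := h₂ M (g 0) (hmax.isRiemannian 0 hmax.zero_mem) hpic
  obtain ⟨r, hr, hanti, hcan⟩ := Hcan M g cov T hmax hT hpic
  refine ⟨ρ, Λ, P, hρ, hΛ, hP, r, hr, hanti, ?_, ?_, ?_⟩
  · exact h₁ M T g cov hmax.isRicciFlow hmax.isRiemannian hpic
  · intro t ht x e he
    simpa only [zero_add] using hpinch T g cov hmax.isRicciFlow hmax.isRiemannian rfl t ht x e he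
  · intro t ht x hR _
    exact hcan t ht x (by simpa only [zero_add] using hR)

/-! ### Theorem 5.6 ⇒ Theorem 1.1 -/

/-- **The existence clause of Thm. 5.6 already gives Thm. 1.1** (Chen–Zhu 2006, p. 43: "Finally,
the main theorem (Theorem 1.1) stated in Section 1 is a direct consequence of the above
theorem"), per manifold and without the uniformity of the constants: if every closed simply
connected PIC 4-manifold `(M, g₀)` (with any Borel structure) is carried to extinction by a
solution with finitely many surgeries satisfying the a priori assumptions for SOME parameters
`𝔭`, started at SOME absolute time, then Thm. 1.1 (`∃ m, ChenZhuResolvableIn m M g₀` for every closed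
simply connected PIC `(M, g₀)`) holds — equip `M` with
its Borel σ-algebra and forget the a priori assumptions (`ChenZhuSurgicalFlowIn.resolvableIn`).
[cite: ChenZhu2006, §5, p. 43 (Thm. 1.1 from Thm. 5.6)] -/
theorem chenZhu_ricciFlowWithSurgery_of_surgicalFlowIn
    (h : ∀ (M : Type) [TopologicalSpace M] [T2Space M] [SecondCountableTopology M]
      [CompactSpace M] [ChartedSpace (EuclideanSpace ℝ (Fin 4)) M] [IsManifold (𝓡 4) ∞ M]
      [SimplyConnectedSpace M] [MeasurableSpace M] [BorelSpace M] (g₀ : Metric₄ M),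
      g₀.IsRiemannian → g₀.HasPositiveIsotropicCurvature →
        ∃ (𝔭 : ChenZhuAPrioriParams) (m : ℕ) (t₀ t₁ : ℝ), ChenZhuSurgicalFlowIn 𝔭 m M g₀ t₀ t₁) :
    ∀ (M : Type) [TopologicalSpace M] [T2Space M] [SecondCountableTopology M]
      [CompactSpace M] [ChartedSpace (EuclideanSpace ℝ (Fin 4)) M] [IsManifold (𝓡 4) ∞ M]
      [SimplyConnectedSpace M]
      (g₀ : Literature.Geometry.Lorentzian.PseudoRiemannianMetric (𝓡 4) ∞
        (EuclideanSpace ℝ (Fin 4)) (TangentSpace (𝓡 4) : M → Type _)),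
      g₀.IsRiemannian → g₀.HasPositiveIsotropicCurvature → ∃ m : ℕ, ChenZhuResolvableIn m M g₀ := by
  intro M _ _ _ _ _ _ _ g₀ hg₀ hpic
  letI : MeasurableSpace M := borel M
  haveI : BorelSpace M := ⟨rfl⟩
  obtain ⟨𝔭, m, t₀, t₁, hflow⟩ := h M g₀ hg₀ hpic
  exact ⟨m, hflow.resolvableIn⟩

/-- **Thm. 5.6 ⇒ Thm. 1.1** (Chen–Zhu 2006, p. 43: "Finally, the main theorem (Theorem 1.1) stated
in Section 1 is a direct consequence of the above theorem"): the structure statement of Thm. 1.1 (`∃ m, ChenZhuResolvableIn m M g₀` for every closed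
simply connected PIC `(M, g₀)`, `SurgicalRicciFlow.lean`) follows from the statement of
**Thm. 5.6** in the rendering of the module docstring (simply connected case; `η` universal,
`ε ≤ ε₀`, `C₁, C₂` depending on `ε`, then `ρ, Λ, P`, `r̃`, and a solution with `m` surgeries
satisfying the a priori assumptions, extinct at `T ≤ 2/R_min(0)`), taken here as an EXPLICIT
HYPOTHESIS — Thm. 5.6 is not a named fact of the tree (D-0026, module docstring); the same
statement, verbatim, is the conclusion of `chenZhu_surgicalSolution_existence_of_step`
(`SurgicalSolutionsCount.lean`), so a proof of the analysis of §5 proves Thm. 1.1 by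
`exact chenZhu_ricciFlowWithSurgery_of_surgicalSolution_existence …`.
Proof: take any admissible accuracy (`ε = ε₀`) and apply
`chenZhu_ricciFlowWithSurgery_of_surgicalFlowIn`.
[cite: ChenZhu2006, Thm. 5.6 (p. 43)] [cite: ChenZhu2006, §5, p. 43 (Thm. 1.1 from Thm. 5.6)] -/
theorem chenZhu_ricciFlowWithSurgery_of_surgicalSolution_existence
    (h : ∃ η : ℝ, 0 < η ∧ ∃ ε₀ : ℝ, 0 < ε₀ ∧ ∀ ε : ℝ, 0 < ε → ε ≤ ε₀ → ∃ C₁ C₂ : ℝ, 0 < C₁ ∧ 0 < C₂ ∧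
      ∀ (M : Type) [TopologicalSpace M] [T2Space M] [SecondCountableTopology M] [CompactSpace M]
        [ChartedSpace (EuclideanSpace ℝ (Fin 4)) M] [IsManifold (𝓡 4) ∞ M] [SimplyConnectedSpace M]
        [MeasurableSpace M] [BorelSpace M]
        (g₀ : PseudoRiemannianMetric (𝓡 4) ∞ (EuclideanSpace ℝ (Fin 4))
          (TangentSpace (𝓡 4) : M → Type _)),
        g₀.IsRiemannian → g₀.HasPositiveIsotropicCurvature →
          ∃ ρ Λ P : ℝ, 0 < ρ ∧ 0 < Λ ∧ 0 < P ∧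
            ∃ r : ℝ → ℝ, (∀ t ∈ Ici (0 : ℝ), 0 < r t) ∧ AntitoneOn r (Ici 0) ∧
              ∃ (m : ℕ) (T : ℝ), ChenZhuSurgicalFlowIn ⟨ε, C₁, C₂, η, ρ, Λ, P, r⟩ m M g₀ 0 T ∧
                ∀ (cov₀ : CovariantDerivative (𝓡 4) (EuclideanSpace ℝ (Fin 4))
                    (TangentSpace (𝓡 4) : M → Type _)) (α : ℝ),
                  g₀.IsLeviCivita cov₀ → 0 < α → (∀ x : M, α ≤ g₀.scalarCurvatureWith cov₀ x) →
                    T ≤ 2 / α) :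
    ∀ (M : Type) [TopologicalSpace M] [T2Space M] [SecondCountableTopology M]
      [CompactSpace M] [ChartedSpace (EuclideanSpace ℝ (Fin 4)) M] [IsManifold (𝓡 4) ∞ M]
      [SimplyConnectedSpace M]
      (g₀ : Literature.Geometry.Lorentzian.PseudoRiemannianMetric (𝓡 4) ∞
        (EuclideanSpace ℝ (Fin 4)) (TangentSpace (𝓡 4) : M → Type _)),
      g₀.IsRiemannian → g₀.HasPositiveIsotropicCurvature → ∃ m : ℕ, ChenZhuResolvableIn m M g₀ := by
  refine chenZhu_ricciFlowWithSurgery_of_surgicalFlowIn fun M _ _ _ _ _ _ _ _ _ g₀ hg₀ hpic ↦ ?_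
  obtain ⟨η, -, ε₀, hε₀, H⟩ := h
  obtain ⟨C₁, C₂, -, -, HM⟩ := H ε₀ hε₀ le_rfl
  obtain ⟨ρ, Λ, P, -, -, -, r, -, -, m, T, hflow, -⟩ := HM M g₀ hg₀ hpic
  exact ⟨⟨ε₀, C₁, C₂, η, ρ, Λ, P, r⟩, m, 0, T, hflow⟩

/-- **From the statement of Thm. 5.6: the extinction time is positive and at most `2/R_min(0)`**
— for every admissible accuracy `ε` and every positive lower bound `α` of the initial scalar
curvature, `0 < T ≤ 2/α` (`ChenZhuSurgicalFlowIn.lt` and the rendered bound), the statement of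
Thm. 5.6 being an explicit hypothesis as in
`chenZhu_ricciFlowWithSurgery_of_surgicalSolution_existence`.
[cite: ChenZhu2006, §5, p. 30 and p. 43] -/
theorem chenZhu_extinctionTime_pos_le_of_surgicalSolution_existence
    (h : ∃ η : ℝ, 0 < η ∧ ∃ ε₀ : ℝ, 0 < ε₀ ∧ ∀ ε : ℝ, 0 < ε → ε ≤ ε₀ → ∃ C₁ C₂ : ℝ, 0 < C₁ ∧ 0 < C₂ ∧
      ∀ (M : Type) [TopologicalSpace M] [T2Space M] [SecondCountableTopology M] [CompactSpace M]
        [ChartedSpace (EuclideanSpace ℝ (Fin 4)) M] [IsManifold (𝓡 4) ∞ M] [SimplyConnectedSpace M]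
        [MeasurableSpace M] [BorelSpace M]
        (g₀ : PseudoRiemannianMetric (𝓡 4) ∞ (EuclideanSpace ℝ (Fin 4))
          (TangentSpace (𝓡 4) : M → Type _)),
        g₀.IsRiemannian → g₀.HasPositiveIsotropicCurvature →
          ∃ ρ Λ P : ℝ, 0 < ρ ∧ 0 < Λ ∧ 0 < P ∧
            ∃ r : ℝ → ℝ, (∀ t ∈ Ici (0 : ℝ), 0 < r t) ∧ AntitoneOn r (Ici 0) ∧
              ∃ (m : ℕ) (T : ℝ), ChenZhuSurgicalFlowIn ⟨ε, C₁, C₂, η, ρ, Λ, P, r⟩ m M g₀ 0 T ∧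
                ∀ (cov₀ : CovariantDerivative (𝓡 4) (EuclideanSpace ℝ (Fin 4))
                    (TangentSpace (𝓡 4) : M → Type _)) (α : ℝ),
                  g₀.IsLeviCivita cov₀ → 0 < α → (∀ x : M, α ≤ g₀.scalarCurvatureWith cov₀ x) →
                    T ≤ 2 / α) :
    ∃ ε₀ : ℝ, 0 < ε₀ ∧
      ∀ (M : Type) [TopologicalSpace M] [T2Space M] [SecondCountableTopology M] [CompactSpace M]
        [ChartedSpace (EuclideanSpace ℝ (Fin 4)) M] [IsManifold (𝓡 4) ∞ M]
        [SimplyConnectedSpace M] [MeasurableSpace M] [BorelSpace M]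
        (g₀ : Metric₄ M), g₀.IsRiemannian → g₀.HasPositiveIsotropicCurvature →
          ∀ ε : ℝ, 0 < ε → ε ≤ ε₀ → ∃ (𝔭 : ChenZhuAPrioriParams) (m : ℕ) (T : ℝ),
            𝔭.ε = ε ∧ ChenZhuSurgicalFlowIn 𝔭 m M g₀ 0 T ∧ 0 < T ∧
              ∀ (cov₀ : Connection₄ M) (α : ℝ), g₀.IsLeviCivita cov₀ → 0 < α →
                (∀ x : M, α ≤ g₀.scalarCurvatureWith cov₀ x) → T ≤ 2 / α := by
  obtain ⟨η, -, ε₀, hε₀, H⟩ := h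
  refine ⟨ε₀, hε₀, fun M _ _ _ _ _ _ _ _ _ g₀ hg₀ hpic ε hε hεε₀ ↦ ?_⟩
  obtain ⟨C₁, C₂, -, -, HM⟩ := H ε hε hεε₀
  obtain ⟨ρ, Λ, P, -, -, -, r, -, -, m, T, hflow, hT⟩ := HM M g₀ hg₀ hpic
  exact ⟨⟨ε, C₁, C₂, η, ρ, Λ, P, r⟩, m, T, rfl, hflow, ChenZhuSurgicalFlowIn.lt m hflow, hT⟩

end Literature.Geometry.Riemannian

end
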